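import Literature.NumberTheory.LFunctions.RayClassPartialZeta
import Literature.NumberTheory.LFunctions.HeckePieceDirichlet
import HarnessLib

/-!
# Unfolding the partial zeta function of a narrow ray class over totally positive elements

Topic `Literature/NumberTheory/LFunctions`; namespace `Literature.NumberTheory.LFunctions`.
The combinatorial half of Hecke's theorem for the partial zeta functions of narrow ray classes
(`rayClassPartialZeta_hasMeromorphicContinuation`, `RayClassPartialZeta.lean`), following Neukirch,
*Algebraic Number Theory*, VII §8, Remark 1 after (8.6) ("splitting the ray class group `J^𝔪/P^𝔪` into
its classes `𝔎`, and then proceeding exactly as for the Dedekind zeta function") together with VII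
(5.3)–(5.4) (`{𝔞 ∈ 𝔎 integral} ≅ 𝔟^*/𝒪^*` for the class `𝔎 = [𝔟]`, here for ray classes) and the proof
of (8.3) (`L(𝔎, χ, s) = Σ_{a ∈ ℜ} χ((a))/|N(a)|^s`, `ℜ` a system of representatives modulo units).

For a module `𝔪 ≠ 0` and a nonzero integral ideal `𝔟` prime to `𝔪` put `𝔠 = 𝔪𝔟⁻¹` and let
`X = {x ∈ K^* | x ≡ 1 mod 𝔠 (i.e. `x - 1 ∈ 𝔠`), x totally positive}`.  We PROVE:

* `x ↦ x𝔟` maps `X` onto the integral ideals `𝔞` in the narrow ray class of `𝔟 mod 𝔪`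
  (`RayClassRel 𝔪 𝔟 𝔞`), two elements having the same image iff they differ by a unit `u ≡ 1 mod 𝔪`,
  `u` totally positive (`rayEltIdeal_unit_mul`, `exists_rayUnit_of_rayEltIdeal_eq`);
* with `N` even, `N ≠ 0`, `u_i^N ≡ 1 mod 𝔪` for Mathlib's fundamental units `u_i` (such `N` exist,
  `exists_even_pow_sub_one_mem`), the elements of `X` whose cone exponent lies in the box
  `[0,N)^{r-1}` (`rayReps 𝔪 𝔟 N`, the representatives modulo `V = ⟨u_i^N⟩` of
  `HeckeThetaPieces.lean`) cover each ideal of the class the same finite number `h = rayMult 𝔪 𝔟 N ≥ 1`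
  of times, whence `Σ_{x ∈ rayReps} |N(x)|^{-s} = h · 𝔑(𝔟)^s · Z_𝔪(𝔟, s)` for `re s > 1`;
* the sign characters of the real places separate the totally positive elements:
  `Σ_{p ⊆ {real places}} sgn N(x^p) = 2^{r₁} 𝟙[x ≫ 0]`, so that
  `Σ_{x ∈ rayReps} |N(x)|^{-s} = 2^{-r₁} Σ_p (D_{p,+}(s) - D_{p,-}(s))` with the signed coset series
  `D_{p,ς} = pieceDirichlet K p ς 𝔠 1 N` of `HeckePieceDirichlet.lean`;
* **`rayClassPartialZeta_eq_sum_pieceDirichlet`**: for `re s > 1`,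
  `Z_𝔪(𝔟, s) = h⁻¹ 2^{-r₁} 𝔑(𝔟)^{-s} Σ_p (D_{p,+}(s) - D_{p,-}(s))`;
* **`rayClassPartialZeta_hasMeromorphicContinuation_of_pieceDirichlet`**: the continuation of the
  signed coset series `D_{p,+} - D_{p,-}` (for all nonzero fractional ideals, `a₀ = 1`, all admissible
  `N` and `p`) implies `rayClassPartialZeta_hasMeromorphicContinuation K`, hence (with
  `rayClassLSeries_hasMeromorphicContinuation_of_partialZeta`) Hecke's theorem for all ray class
  characters of `K`.

## References

* J. Neukirch, *Algebraic Number Theory*, Grundlehren 322, Springer 1999, Ch. VI §1 (1.7)–(1.9); Ch. VII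
  §5 (5.3)–(5.4), §6 (6.8)–(6.9), §8 proof of (8.3), (8.5) and Remark 1 after (8.6). [NeukirchANT1999]
* E. Hecke, *Über eine neue Anwendung der Zetafunktionen auf die Arithmetik der Zahlkörper*,
  Nachr. Ges. Wiss. Göttingen (1917), 90–95.
-/

noncomputable section

open IsDedekindDomain NumberField.InfinitePlace NumberField.Units
open scoped nonZeroDivisors NumberField

namespace Literature.NumberTheory.LFunctions

variable {K : Type*} [Field K] [NumberField K]

open scoped Classical

/-! ### The modulus `𝔠 = 𝔪𝔟⁻¹` and the element set `X` -/

variable (K) in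
/-- The fractional ideal `𝔠 = 𝔪 𝔟⁻¹`: for `𝔟` prime to `𝔪`, an element `x ∈ 𝔟⁻¹` satisfies `x ≡ 1 mod 𝔪`
(multiplicatively) iff `x - 1 ∈ 𝔪𝔟⁻¹`. [folklore] -/
def rayModulus (𝔪 𝔟 : Ideal (𝓞 K)) : FractionalIdeal (𝓞 K)⁰ K :=
  (𝔪 : FractionalIdeal (𝓞 K)⁰ K) * (𝔟 : FractionalIdeal (𝓞 K)⁰ K)⁻¹

/-- **The element set `X(𝔪, 𝔟)`**: nonzero `x ∈ K` with `x - 1 ∈ 𝔪𝔟⁻¹` and `x` totally positive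
(`φ x > 0` for every real embedding `φ`) — the elements `a = b/c` with `(a) 𝔟` integral in the narrow
ray class of `𝔟 mod 𝔪` (Neukirch VI §1: `a ≡ 1 mod 𝔪`, `a` totally positive).
[cite: NeukirchANT1999, Ch. VI §1 Def. (1.7)] -/
def rayElts (𝔪 𝔟 : Ideal (𝓞 K)) : Set K :=
  {x | x ≠ 0 ∧ x - 1 ∈ rayModulus K 𝔪 𝔟 ∧ ∀ φ : K →+* ℝ, 0 < φ x}

/-- `1 ∈ X`. [folklore] -/
theorem one_mem_rayElts (𝔪 𝔟 : Ideal (𝓞 K)) : (1 : K) ∈ rayElts 𝔪 𝔟 := by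
  refine ⟨one_ne_zero, by rw [sub_self]; exact FractionalIdeal.zero_mem _, fun φ ↦ by simp⟩

/-- `𝔪 ⊆ 𝔪𝔟⁻¹` for an integral ideal `𝔟 ≠ 0` (`1 ∈ 𝔟⁻¹`). [folklore] -/
theorem coeIdeal_le_rayModulus (𝔪 : Ideal (𝓞 K)) {𝔟 : Ideal (𝓞 K)} (h𝔟 : 𝔟 ≠ ⊥) :
    (𝔪 : FractionalIdeal (𝓞 K)⁰ K) ≤ rayModulus K 𝔪 𝔟 := by
  have h1 : (1 : K) ∈ (𝔟 : FractionalIdeal (𝓞 K)⁰ K)⁻¹ := by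
    rw [FractionalIdeal.mem_inv_iff (FractionalIdeal.coeIdeal_ne_zero.mpr h𝔟)]
    intro y hy
    rw [one_mul]
    exact FractionalIdeal.coeIdeal_le_one hy
  intro y hy
  rw [rayModulus]
  have := FractionalIdeal.mul_mem_mul hy h1
  rwa [mul_one] at this


/-- `𝔪𝔟⁻¹ · 𝔟 = 𝔪`. [folklore] -/
theorem rayModulus_mul_coeIdeal (𝔪 : Ideal (𝓞 K)) {𝔟 : Ideal (𝓞 K)} (h𝔟 : 𝔟 ≠ ⊥) :
    rayModulus K 𝔪 𝔟 * (𝔟 : FractionalIdeal (𝓞 K)⁰ K) = 𝔪 := by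
  rw [rayModulus, mul_assoc, inv_mul_cancel₀ (FractionalIdeal.coeIdeal_ne_zero.mpr h𝔟), mul_one]

/-- An element `z` with `z 𝔟 ⊆ 𝔪` lies in `𝔪𝔟⁻¹`. [folklore] -/
theorem mem_rayModulus_of_forall_mul_mem (𝔪 : Ideal (𝓞 K)) {𝔟 : Ideal (𝓞 K)} (h𝔟 : 𝔟 ≠ ⊥) {z : K}
    (h : ∀ β ∈ (𝔟 : FractionalIdeal (𝓞 K)⁰ K), z * β ∈ (𝔪 : FractionalIdeal (𝓞 K)⁰ K)) :
    z ∈ rayModulus K 𝔪 𝔟 := by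
  have h𝔟' : (𝔟 : FractionalIdeal (𝓞 K)⁰ K) ≠ 0 := FractionalIdeal.coeIdeal_ne_zero.mpr h𝔟
  -- `z ∈ z · 1 = 𝔟⁻¹ ((z) 𝔟) ⊆ 𝔟⁻¹ 𝔪`
  have hz : z ∈ (𝔟 : FractionalIdeal (𝓞 K)⁰ K)⁻¹ *
      (FractionalIdeal.spanSingleton (𝓞 K)⁰ z * (𝔟 : FractionalIdeal (𝓞 K)⁰ K)) := by
    rw [mul_comm, mul_assoc, mul_inv_cancel₀ h𝔟', mul_one]
    exact FractionalIdeal.mem_spanSingleton_self _ z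
  have hle : FractionalIdeal.spanSingleton (𝓞 K)⁰ z * (𝔟 : FractionalIdeal (𝓞 K)⁰ K) ≤ 𝔪 := by
    intro y hy
    obtain ⟨β, hβ, rfl⟩ := FractionalIdeal.mem_singleton_mul.mp hy
    exact h β hβ
  rw [rayModulus, mul_comm]
  exact mul_le_mul_right hle _ hz

/-! ### The ideal `x𝔟` of an element `x ≡ 1 mod 𝔪𝔟⁻¹` -/

section Elt

variable {𝔪 𝔟 : Ideal (𝓞 K)}

/-- For `x - 1 ∈ 𝔪𝔟⁻¹` the fractional ideal `x𝔟` is integral: `xβ = β + (x-1)β ∈ 𝔟 + 𝔪`. [folklore] -/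
theorem spanSingleton_mul_coeIdeal_le_one (h𝔟 : 𝔟 ≠ ⊥) {x : K} (hx : x - 1 ∈ rayModulus K 𝔪 𝔟) :
    FractionalIdeal.spanSingleton (𝓞 K)⁰ x * (𝔟 : FractionalIdeal (𝓞 K)⁰ K) ≤ 1 := by
  intro y hy
  obtain ⟨β, hβ, rfl⟩ := FractionalIdeal.mem_singleton_mul.mp hy
  have hkey : (x - 1) * β ∈ (𝔪 : FractionalIdeal (𝓞 K)⁰ K) := by
    have := FractionalIdeal.mul_mem_mul hx hβ
    rwa [rayModulus_mul_coeIdeal 𝔪 h𝔟] at this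
  have : x * β = β + (x - 1) * β := by ring
  rw [this]
  exact (1 : FractionalIdeal (𝓞 K)⁰ K).val.add_mem (FractionalIdeal.coeIdeal_le_one hβ)
    (FractionalIdeal.coeIdeal_le_one hkey)

/-- **The integral ideal `x𝔟`** attached to `x` with `x - 1 ∈ 𝔪𝔟⁻¹` (Neukirch VII (5.3): `𝔟 ↦ a𝔞⁻¹`,
here `x ↦ x𝔟`). [cite: NeukirchANT1999, Ch. VII §5 (5.3)] -/
def rayEltIdeal (h𝔟 : 𝔟 ≠ ⊥) {x : K} (hx : x - 1 ∈ rayModulus K 𝔪 𝔟) : Ideal (𝓞 K) :=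
  (FractionalIdeal.le_one_iff_exists_coeIdeal.mp (spanSingleton_mul_coeIdeal_le_one h𝔟 hx)).choose

/-- `x𝔟` as a fractional ideal. [folklore] -/
theorem coe_rayEltIdeal (h𝔟 : 𝔟 ≠ ⊥) {x : K} (hx : x - 1 ∈ rayModulus K 𝔪 𝔟) :
    (rayEltIdeal h𝔟 hx : FractionalIdeal (𝓞 K)⁰ K) =
      FractionalIdeal.spanSingleton (𝓞 K)⁰ x * (𝔟 : FractionalIdeal (𝓞 K)⁰ K) :=
  (FractionalIdeal.le_one_iff_exists_coeIdeal.mp (spanSingleton_mul_coeIdeal_le_one h𝔟 hx)).choose_spec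

omit [NumberField K] in
/-- A nonzero element of `𝔟` congruent to `1 mod 𝔪` (from `𝔟 + 𝔪 = 1`). [folklore] -/
theorem exists_mem_ne_zero_sub_one_mem (h𝔟 : 𝔟 ≠ ⊥) (hcop : IsCoprime 𝔟 𝔪) :
    ∃ c : 𝓞 K, c ∈ 𝔟 ∧ c ≠ 0 ∧ c - 1 ∈ 𝔪 := by
  obtain ⟨a, ha, m, hm, ham⟩ := Ideal.isCoprime_iff_exists.mp hcop
  by_cases ha0 : a = 0
  · have hm1 : 𝔪 = ⊤ := by
      rw [ha0, zero_add] at ham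
      exact Ideal.eq_top_of_isUnit_mem _ hm (ham ▸ isUnit_one)
    obtain ⟨c, hc, hc0⟩ := Submodule.exists_mem_ne_zero_of_ne_bot h𝔟
    exact ⟨c, hc, hc0, hm1 ▸ Submodule.mem_top⟩
  · refine ⟨a, ha, ha0, ?_⟩
    have : a - 1 = -m := by rw [← ham]; ring
    rw [this]
    exact 𝔪.neg_mem hm

/-- **Elements of `X` give ideals in the narrow ray class**: for `x ∈ X(𝔪,𝔟)` (and `𝔟 ≠ 0` prime to `𝔪`),
`RayClassRel 𝔪 𝔟 (x𝔟)` — with `c ∈ 𝔟`, `c ≡ 1 mod 𝔪`, and `b = cx`: `(c)(x𝔟) = (b)𝔟`, `b ≡ c mod 𝔪`, `b/c = x`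
totally positive (Neukirch VI (1.7) unfolded as in `RayClasses.lean`). [cite: NeukirchANT1999, Ch. VI §1 Def. (1.7)] -/
theorem rayClassRel_rayEltIdeal (h𝔟 : 𝔟 ≠ ⊥) (hcop : IsCoprime 𝔟 𝔪) {x : K} (hx : x ∈ rayElts 𝔪 𝔟) :
    RayClassRel 𝔪 𝔟 (rayEltIdeal h𝔟 hx.2.1) := by
  obtain ⟨hx0, hx1, hpos⟩ := hx
  obtain ⟨c, hc𝔟, hc0, hc1⟩ := exists_mem_ne_zero_sub_one_mem h𝔟 hcop
  -- `c (x - 1) ∈ 𝔪`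
  have hcK : (c : K) ∈ (𝔟 : FractionalIdeal (𝓞 K)⁰ K) := FractionalIdeal.mem_coeIdeal_of_mem _ hc𝔟
  have hcx : (c : K) * (x - 1) ∈ (𝔪 : FractionalIdeal (𝓞 K)⁰ K) := by
    have := FractionalIdeal.mul_mem_mul hx1 hcK
    rw [rayModulus_mul_coeIdeal 𝔪 h𝔟] at this
    rwa [mul_comm] at this
  obtain ⟨m, hm, hmeq⟩ := (FractionalIdeal.mem_coeIdeal _).mp hcx
  -- `b = c + m`, `b = c x` in `K`
  set b : 𝓞 K := c + m with hb
  have hbK : (b : K) = (c : K) * x := by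
    show algebraMap (𝓞 K) K b = algebraMap (𝓞 K) K c * x
    rw [hb, map_add, hmeq]; ring
  have hcK0 : (c : K) ≠ 0 := NumberField.RingOfIntegers.coe_ne_zero_iff.mpr hc0
  have hb0 : b ≠ 0 := by
    intro h
    have : (c : K) * x = 0 := by rw [← hbK, h]; rfl
    exact mul_ne_zero hcK0 hx0 this
  refine ⟨b, c, hb0, hc0, ?_, ?_, fun φ ↦ ?_, ?_⟩
  · -- `(c) + 𝔪 = 1`
    refine Ideal.isCoprime_iff_exists.mpr ⟨c, Ideal.mem_span_singleton_self c, 1 - c, ?_, by ring⟩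
    have : 1 - c = -(c - 1) := by ring
    rw [this]; exact 𝔪.neg_mem hc1
  · -- `b - c = m ∈ 𝔪`
    have : b - c = m := by rw [hb]; ring
    rw [this]; exact hm
  · -- total positivity of `b c = c² x`
    have hφc : φ c ≠ 0 := (map_ne_zero φ).mpr hcK0
    rw [hbK, map_mul]
    have := hpos φ
    nlinarith [sq_nonneg (φ c), sq_pos_of_ne_zero hφc]
  · -- `(c)(x𝔟) = (b)𝔟`
    refine (FractionalIdeal.coeIdeal_inj (K := K)).mp ?_
    rw [FractionalIdeal.coeIdeal_mul, FractionalIdeal.coeIdeal_mul, coe_rayEltIdeal,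
      FractionalIdeal.coeIdeal_span_singleton, FractionalIdeal.coeIdeal_span_singleton, ← mul_assoc,
      FractionalIdeal.spanSingleton_mul_spanSingleton]
    congr 2
    exact hbK.symm

omit [NumberField K] in
/-- Cancelling a principal ideal prime to `𝔪`: `(c) + 𝔪 = 1`, `c t ∈ 𝔪` ⟹ `t ∈ 𝔪`. [folklore] -/
theorem mem_of_isCoprime_span_of_mul_mem {c t : 𝓞 K} (hc : IsCoprime (Ideal.span {c}) 𝔪) (h : c * t ∈ 𝔪) :
    t ∈ 𝔪 := by
  obtain ⟨i, hi, j, hj, hij⟩ := Ideal.isCoprime_iff_exists.mp hc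
  obtain ⟨r, rfl⟩ := Ideal.mem_span_singleton'.mp hi
  have : t = r * (c * t) + j * t := by linear_combination (-t) * hij
  rw [this]
  exact 𝔪.add_mem (𝔪.mul_mem_left r h) (𝔪.mul_mem_right t hj)

/-- **Every ideal of the narrow ray class of `𝔟` is `x𝔟` with `x ∈ X`** (`x = b/c` for the data
`(c)𝔞 = (b)𝔟` of `RayClassRel`; `x - 1 ∈ 𝔪𝔟⁻¹` because `c (x-1) β = (b - c) β ∈ 𝔪` for `β ∈ 𝔟` and `(c)`
is prime to `𝔪`). [cite: NeukirchANT1999, Ch. VI §1 Def. (1.7)] -/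
theorem exists_rayElt_of_rayClassRel (h𝔟 : 𝔟 ≠ ⊥) {𝔞 : Ideal (𝓞 K)} (h : RayClassRel 𝔪 𝔟 𝔞) :
    ∃ x : K, ∃ hx : x ∈ rayElts 𝔪 𝔟, rayEltIdeal h𝔟 hx.2.1 = 𝔞 := by
  obtain ⟨b, c, hb, hc, hcop, hbc, hpos, heq⟩ := h
  have hcK : (c : K) ≠ 0 := NumberField.RingOfIntegers.coe_ne_zero_iff.mpr hc
  have hbK : (b : K) ≠ 0 := NumberField.RingOfIntegers.coe_ne_zero_iff.mpr hb
  set x : K := (b : K) / (c : K) with hxdef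
  have hcx : (c : K) * x = b := by rw [hxdef]; field_simp
  have hcx' : algebraMap (𝓞 K) K c * x = algebraMap (𝓞 K) K b := hcx
  -- the ideal equation as fractional ideals: `𝔞 = x 𝔟`
  have hfrac : (𝔞 : FractionalIdeal (𝓞 K)⁰ K) =
      FractionalIdeal.spanSingleton (𝓞 K)⁰ x * (𝔟 : FractionalIdeal (𝓞 K)⁰ K) := by
    have h1 : FractionalIdeal.spanSingleton (𝓞 K)⁰ (c : K) * (𝔞 : FractionalIdeal (𝓞 K)⁰ K) =
        FractionalIdeal.spanSingleton (𝓞 K)⁰ (b : K) * (𝔟 : FractionalIdeal (𝓞 K)⁰ K) := by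
      have := (FractionalIdeal.coeIdeal_inj (K := K)).mpr heq
      simpa only [FractionalIdeal.coeIdeal_mul, FractionalIdeal.coeIdeal_span_singleton] using this
    have hcc : FractionalIdeal.spanSingleton (𝓞 K)⁰ (c : K)⁻¹ * FractionalIdeal.spanSingleton (𝓞 K)⁰ (c : K) = 1 := by
      rw [FractionalIdeal.spanSingleton_mul_spanSingleton, inv_mul_cancel₀ hcK, FractionalIdeal.spanSingleton_one]
    calc (𝔞 : FractionalIdeal (𝓞 K)⁰ K)
        = FractionalIdeal.spanSingleton (𝓞 K)⁰ (c : K)⁻¹ *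
            (FractionalIdeal.spanSingleton (𝓞 K)⁰ (c : K) * (𝔞 : FractionalIdeal (𝓞 K)⁰ K)) := by
          rw [← mul_assoc, hcc, one_mul]
      _ = FractionalIdeal.spanSingleton (𝓞 K)⁰ ((c : K)⁻¹ * (b : K)) * (𝔟 : FractionalIdeal (𝓞 K)⁰ K) := by
          rw [h1, ← mul_assoc, FractionalIdeal.spanSingleton_mul_spanSingleton]
      _ = FractionalIdeal.spanSingleton (𝓞 K)⁰ x * (𝔟 : FractionalIdeal (𝓞 K)⁰ K) := by
          rw [hxdef, div_eq_inv_mul]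
  -- `x ∈ X`
  have hx1 : x - 1 ∈ rayModulus K 𝔪 𝔟 := by
    refine mem_rayModulus_of_forall_mul_mem 𝔪 h𝔟 fun β hβ ↦ ?_
    -- `x β ∈ 𝔞`
    have hxβ : x * β ∈ (𝔞 : FractionalIdeal (𝓞 K)⁰ K) := by
      rw [hfrac]
      exact FractionalIdeal.mul_mem_mul (FractionalIdeal.mem_spanSingleton_self _ x) hβ
    obtain ⟨a, -, ha⟩ := (FractionalIdeal.mem_coeIdeal _).mp hxβ
    obtain ⟨β', hβ', hβ'eq⟩ := (FractionalIdeal.mem_coeIdeal _).mp hβ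
    -- `t = a - β'` satisfies `c t = (b - c) β' ∈ 𝔪`
    have hct : c * (a - β') ∈ 𝔪 := by
      have hK : algebraMap (𝓞 K) K (c * (a - β')) = algebraMap (𝓞 K) K ((b - c) * β') := by
        rw [map_mul, map_sub, map_mul, map_sub, ha, hβ'eq, ← hcx']
        ring
      rw [NumberField.RingOfIntegers.coe_injective hK]
      exact 𝔪.mul_mem_right _ hbc
    have ht : a - β' ∈ 𝔪 := mem_of_isCoprime_span_of_mul_mem hcop hct
    have : (x - 1) * β = algebraMap (𝓞 K) K (a - β') := by rw [map_sub, ha, hβ'eq]; ring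
    rw [this]
    exact FractionalIdeal.mem_coeIdeal_of_mem _ ht
  have hx : x ∈ rayElts 𝔪 𝔟 := by
    refine ⟨div_ne_zero hbK hcK, hx1, fun φ ↦ ?_⟩
    have h := hpos φ
    have hφc : φ c ≠ 0 := (map_ne_zero φ).mpr hcK
    rw [hxdef, map_div₀]
    have : φ (b : K) / φ (c : K) = φ (b : K) * φ (c : K) / (φ (c : K)) ^ 2 := by
      field_simp
    rw [this]
    positivity
  refine ⟨x, hx, ?_⟩
  refine (FractionalIdeal.coeIdeal_inj (K := K)).mp ?_
  rw [coe_rayEltIdeal, ← hfrac]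

end Elt


/-! ### Units `≡ 1 mod 𝔪` that are totally positive, and their action on `X` -/

/-- Reduction of units modulo `𝔪`: `𝒪^* → (𝒪/𝔪)^*`. [folklore] -/
def unitsModHom (𝔪 : Ideal (𝓞 K)) : (𝓞 K)ˣ →* (𝓞 K ⧸ 𝔪)ˣ :=
  Units.map (Ideal.Quotient.mk 𝔪 : 𝓞 K →+* 𝓞 K ⧸ 𝔪).toMonoidHom

omit [NumberField K] in
/-- `u ↦ 1` in `(𝒪/𝔪)^*` iff `u ≡ 1 mod 𝔪`. [folklore] -/
theorem unitsModHom_eq_one_iff (𝔪 : Ideal (𝓞 K)) (u : (𝓞 K)ˣ) :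
    unitsModHom 𝔪 u = 1 ↔ (u : 𝓞 K) - 1 ∈ 𝔪 := by
  rw [Units.ext_iff, unitsModHom, Units.coe_map, Units.val_one, RingHom.toMonoidHom_eq_coe,
    MonoidHom.coe_coe, ← (Ideal.Quotient.mk 𝔪).map_one, Ideal.Quotient.eq]

/-- The totally positive units. [folklore] -/
def posUnits (K : Type*) [Field K] [NumberField K] : Subgroup (𝓞 K)ˣ where
  carrier := {u | ∀ φ : K →+* ℝ, 0 < φ ((u : 𝓞 K) : K)}
  mul_mem' {u v} hu hv φ := by
    have : (((u * v : (𝓞 K)ˣ) : 𝓞 K) : K) = ((u : 𝓞 K) : K) * ((v : 𝓞 K) : K) := by push_cast; rfl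
    rw [this, map_mul]
    exact mul_pos (hu φ) (hv φ)
  one_mem' φ := by simp
  inv_mem' {u} hu φ := by
    have h1 : (((u⁻¹ : (𝓞 K)ˣ) : 𝓞 K) : K) * ((u : 𝓞 K) : K) = 1 := by
      rw [← map_mul (algebraMap (𝓞 K) K), ← Units.val_mul, inv_mul_cancel, Units.val_one, map_one]
    have hu0 : φ ((u : 𝓞 K) : K) ≠ 0 := (hu φ).ne'
    have : φ (((u⁻¹ : (𝓞 K)ˣ) : 𝓞 K) : K) = (φ ((u : 𝓞 K) : K))⁻¹ :=
      eq_inv_of_mul_eq_one_left (by rw [← map_mul, h1, map_one])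
    rw [this]
    exact inv_pos.mpr (hu φ)

/-- **The units of the narrow ray `mod 𝔪`**: `u ∈ 𝒪^*` with `u ≡ 1 mod 𝔪` and `u` totally positive (the
group `𝒪_+^𝔪` of Neukirch VI (1.9), exact sequence `1 → 𝒪_+^*/𝒪_+^𝔪 → …`).
[cite: NeukirchANT1999, Ch. VI §1 (1.9)] -/
def narrowRayUnits (𝔪 : Ideal (𝓞 K)) : Subgroup (𝓞 K)ˣ :=
  (unitsModHom 𝔪).ker ⊓ posUnits K

/-- Membership in `narrowRayUnits`. [folklore] -/
theorem mem_narrowRayUnits_iff {𝔪 : Ideal (𝓞 K)} {u : (𝓞 K)ˣ} :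
    u ∈ narrowRayUnits 𝔪 ↔ (u : 𝓞 K) - 1 ∈ 𝔪 ∧ ∀ φ : K →+* ℝ, 0 < φ ((u : 𝓞 K) : K) := by
  rw [narrowRayUnits, Subgroup.mem_inf, MonoidHom.mem_ker, unitsModHom_eq_one_iff]
  rfl

section Units

variable {𝔪 𝔟 : Ideal (𝓞 K)}

/-- **`𝒪_+^𝔪` acts on `X`**: `ux - 1 = u(x - 1) + (u - 1) ∈ 𝔪𝔟⁻¹ + 𝔪`. [folklore] -/
theorem unit_mul_mem_rayElts (h𝔟 : 𝔟 ≠ ⊥) {u : (𝓞 K)ˣ} (hu : u ∈ narrowRayUnits 𝔪) {x : K} (hx : x ∈ rayElts 𝔪 𝔟) :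
    ((u : 𝓞 K) : K) * x ∈ rayElts 𝔪 𝔟 := by
  obtain ⟨hu1, hupos⟩ := mem_narrowRayUnits_iff.mp hu
  obtain ⟨hx0, hx1, hpos⟩ := hx
  refine ⟨mul_ne_zero (NumberField.RingOfIntegers.coe_ne_zero_iff.mpr (Units.ne_zero u)) hx0, ?_,
    fun φ ↦ by rw [map_mul]; exact mul_pos (hupos φ) (hpos φ)⟩
  have h1 : ((u : 𝓞 K) : K) * (x - 1) ∈ rayModulus K 𝔪 𝔟 := by
    have := (rayModulus K 𝔪 𝔟).val.smul_mem (u : 𝓞 K) hx1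
    rwa [Algebra.smul_def] at this
  have h2 : ((u : 𝓞 K) : K) - 1 ∈ rayModulus K 𝔪 𝔟 := by
    have := coeIdeal_le_rayModulus 𝔪 h𝔟 (FractionalIdeal.mem_coeIdeal_of_mem (𝓞 K)⁰ hu1)
    rwa [map_sub, map_one] at this
  have : ((u : 𝓞 K) : K) * x - 1 = ((u : 𝓞 K) : K) * (x - 1) + (((u : 𝓞 K) : K) - 1) := by ring
  rw [this]
  exact (rayModulus K 𝔪 𝔟).val.add_mem h1 h2

/-- Multiplying by a unit does not change the ideal `x𝔟`. [folklore] -/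
theorem rayEltIdeal_unit_mul (h𝔟 : 𝔟 ≠ ⊥) (u : (𝓞 K)ˣ) {x : K} (hx : x - 1 ∈ rayModulus K 𝔪 𝔟)
    (hux : ((u : 𝓞 K) : K) * x - 1 ∈ rayModulus K 𝔪 𝔟) : rayEltIdeal h𝔟 hux = rayEltIdeal h𝔟 hx := by
  refine (FractionalIdeal.coeIdeal_inj (K := K)).mp ?_
  rw [coe_rayEltIdeal, coe_rayEltIdeal]
  congr 1
  exact FractionalIdeal.spanSingleton_eq_spanSingleton.mpr ⟨u⁻¹, by
    rw [Units.smul_def, Algebra.smul_def, ← mul_assoc, ← map_mul, ← Units.val_mul, inv_mul_cancel,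
      Units.val_one, map_one, one_mul]⟩

/-- **Fibres of `x ↦ x𝔟` are orbits of `𝒪_+^𝔪`**: if `x, y ∈ X` give the same ideal then `y = ux` with
`u ∈ 𝒪^*`, and `u ≡ 1 mod 𝔪` because `(u-1) x𝔟 ⊆ 𝔪` with `x𝔟` prime to `𝔪`, `u` totally positive as
`u = y/x` (Neukirch VI (1.9)). [cite: NeukirchANT1999, Ch. VI §1 (1.9)] -/
theorem exists_rayUnit_of_rayEltIdeal_eq (h𝔟 : 𝔟 ≠ ⊥) (hcop : IsCoprime 𝔟 𝔪) {x y : K}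
    (hx : x ∈ rayElts 𝔪 𝔟) (hy : y ∈ rayElts 𝔪 𝔟) (h : rayEltIdeal h𝔟 hx.2.1 = rayEltIdeal h𝔟 hy.2.1) :
    ∃ u ∈ narrowRayUnits 𝔪, y = ((u : 𝓞 K) : K) * x := by
  have h𝔟' : (𝔟 : FractionalIdeal (𝓞 K)⁰ K) ≠ 0 := FractionalIdeal.coeIdeal_ne_zero.mpr h𝔟
  have hcoe := congrArg (fun I : Ideal (𝓞 K) ↦ (I : FractionalIdeal (𝓞 K)⁰ K)) h
  simp only [coe_rayEltIdeal] at hcoe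
  have hspan : FractionalIdeal.spanSingleton (𝓞 K)⁰ x = FractionalIdeal.spanSingleton (𝓞 K)⁰ y :=
    mul_right_cancel₀ h𝔟' hcoe
  obtain ⟨u, hu⟩ := FractionalIdeal.spanSingleton_eq_spanSingleton.mp hspan
  rw [Units.smul_def, Algebra.smul_def] at hu
  -- `hu : u * x = y`
  refine ⟨u, mem_narrowRayUnits_iff.mpr ⟨?_, fun φ ↦ ?_⟩, hu.symm⟩
  · -- `u - 1 ∈ 𝔪`
    set 𝔞 := rayEltIdeal h𝔟 hx.2.1 with h𝔞
    have hcop𝔞 : IsCoprime 𝔞 𝔪 := (rayClassRel_rayEltIdeal h𝔟 hcop hx).isCoprime_iff.mpr hcop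
    -- `(u - 1) x ∈ 𝔪𝔟⁻¹`
    have hux : (((u : 𝓞 K) : K) - 1) * x ∈ rayModulus K 𝔪 𝔟 := by
      have : (((u : 𝓞 K) : K) - 1) * x = (y - 1) - (x - 1) := by rw [← hu]; ring
      rw [this]
      exact (rayModulus K 𝔪 𝔟).val.sub_mem hy.2.1 hx.2.1
    -- hence `(u - 1) a ∈ 𝔪` for all `a ∈ 𝔞 = x𝔟`
    have hmul : ∀ a ∈ 𝔞, ((u : 𝓞 K) - 1) * a ∈ 𝔪 := by
      intro a ha
      have haK : (a : K) ∈ (𝔞 : FractionalIdeal (𝓞 K)⁰ K) := FractionalIdeal.mem_coeIdeal_of_mem _ ha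
      rw [h𝔞, coe_rayEltIdeal] at haK
      obtain ⟨β, hβ, haβ⟩ := FractionalIdeal.mem_singleton_mul.mp haK
      have hmem : (((u : 𝓞 K) : K) - 1) * x * β ∈ (𝔪 : FractionalIdeal (𝓞 K)⁰ K) := by
        rw [← rayModulus_mul_coeIdeal 𝔪 h𝔟]
        exact FractionalIdeal.mul_mem_mul hux hβ
      have hcast : (((u : 𝓞 K) : K) - 1) * x * β = algebraMap (𝓞 K) K (((u : 𝓞 K) - 1) * a) := by
        rw [mul_assoc, ← haβ, map_mul, map_sub, map_one]
      rw [hcast] at hmem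
      obtain ⟨t, ht, hteq⟩ := (FractionalIdeal.mem_coeIdeal _).mp hmem
      rwa [← NumberField.RingOfIntegers.coe_injective hteq]
    obtain ⟨a, ha, m, hm, ham⟩ := Ideal.isCoprime_iff_exists.mp hcop𝔞
    have : (u : 𝓞 K) - 1 = ((u : 𝓞 K) - 1) * a + ((u : 𝓞 K) - 1) * m := by rw [← mul_add, ham, mul_one]
    rw [this]
    exact 𝔪.add_mem (hmul a ha) (𝔪.mul_mem_left _ hm)
  · -- positivity of `u = y/x`
    have hφ : φ ((u : 𝓞 K) : K) * φ x = φ y := by rw [← map_mul, hu]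
    have hx' := hx.2.2 φ
    have hy' := hy.2.2 φ
    nlinarith

end Units

/-! ### Box representatives modulo `V = ⟨u_i^N⟩` -/

variable (K) in
/-- The **box representative** of `x` modulo `V = ⟨u_i^N⟩`: `u_{N⌊m(x)/N⌋} x`, whose cone exponent lies in
`[0,N)^{r-1}` (`HeckeThetaPieces.coneExp_rep_mem_Ico`). [folklore] -/
def boxRep (N : ℕ) (x : K) : K :=
  (NumberField.fundUnit K (N • fun i ↦ NumberField.coneExp x i / (N : ℤ)) : K) * x

/-- `x` lies in the box: `m(x) ∈ [0,N)^{r-1}`. [folklore] -/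
def InConeBox (N : ℕ) (x : K) : Prop :=
  ∀ i, NumberField.coneExp x i ∈ Set.Ico (0 : ℤ) N

/-- The box representative lies in the box. [folklore] -/
theorem inConeBox_boxRep {N : ℕ} (hN0 : N ≠ 0) {x : K} (hx : x ≠ 0) : InConeBox N (boxRep K N x) :=
  fun i ↦ NumberField.coneExp_rep_mem_Ico hN0 hx i

/-- An element of the box is its own representative. [folklore] -/
theorem boxRep_eq_self {N : ℕ} {x : K} (hbox : InConeBox N x) : boxRep K N x = x := by
  have h0 : (fun i ↦ NumberField.coneExp x i / (N : ℤ)) = 0 := by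
    funext i
    exact Int.ediv_eq_zero_of_lt (hbox i).1 (hbox i).2
  rw [boxRep, h0, smul_zero, NumberField.fundUnit_zero, Units.val_one, map_one, one_mul]

/-- The box representative is `V`-invariant: `boxRep (u_{Nq} x) = boxRep x`. [folklore] -/
theorem boxRep_fundUnit_nsmul_mul {N : ℕ} (hN0 : N ≠ 0) {x : K} (hx : x ≠ 0) (q : Fin (rank K) → ℤ) :
    boxRep K N ((NumberField.fundUnit K (N • q) : K) * x) = boxRep K N x := by
  have hN' : (N : ℤ) ≠ 0 := by exact_mod_cast hN0
  have hdiv : (fun i ↦ NumberField.coneExp ((NumberField.fundUnit K (N • q) : K) * x) i / (N : ℤ)) =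
      (fun i ↦ NumberField.coneExp x i / (N : ℤ)) - q := by
    funext i
    rw [NumberField.coneExp_fundUnit_mul _ hx, Pi.sub_apply, Pi.sub_apply, Pi.smul_apply, nsmul_eq_mul,
      show NumberField.coneExp x i - (N : ℤ) * q i = NumberField.coneExp x i + (N : ℤ) * (-q i) by ring,
      Int.add_mul_ediv_left _ _ hN']
    ring
  rw [boxRep, hdiv, boxRep, ← mul_assoc, ← map_mul, ← Units.val_mul, ← NumberField.fundUnit_add, smul_sub,
    sub_add_cancel]

/-- `boxRep x = u_{Nq} x` for some `q`. [folklore] -/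
theorem boxRep_eq_fundUnit_mul (N : ℕ) (x : K) :
    ∃ q : Fin (rank K) → ℤ, boxRep K N x = (NumberField.fundUnit K (N • q) : K) * x :=
  ⟨_, rfl⟩

/-- **`V ≤ 𝒪_+^𝔪`**: for even `N` with `u_i^N ≡ 1 mod 𝔪`, every `u_{Nq}` is `≡ 1 mod 𝔪` and totally positive
(a square). [folklore] -/
theorem fundUnit_nsmul_mem_narrowRayUnits {𝔪 : Ideal (𝓞 K)} {N : ℕ} (hN : Even N)
    (hNm : ∀ i, ((fundSystem K i : (𝓞 K)ˣ) : 𝓞 K) ^ N - 1 ∈ 𝔪) (q : Fin (rank K) → ℤ) :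
    NumberField.fundUnit K (N • q) ∈ narrowRayUnits 𝔪 := by
  refine Subgroup.mem_inf.mpr ⟨?_, fun φ ↦ ?_⟩
  · rw [NumberField.fundUnit]
    refine Subgroup.prod_mem _ fun i _ ↦ ?_
    rw [Pi.smul_apply, nsmul_eq_mul, zpow_mul, zpow_natCast]
    refine Subgroup.zpow_mem _ ?_ _
    rw [MonoidHom.mem_ker, unitsModHom_eq_one_iff, Units.val_pow_eq_pow_val]
    exact hNm i
  · have hsq := NumberField.fundUnit_nsmul_eq_sq hN q
    have hne : (NumberField.fundUnit K ((N / 2) • q) : K) ≠ 0 := NumberField.Units.coe_ne_zero _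
    change 0 < φ (NumberField.fundUnit K (N • q) : K)
    rw [hsq, map_pow]
    exact sq_pos_of_ne_zero ((map_ne_zero φ).mpr hne)

/-- **A suitable exponent `N`**: there is an even `N ≠ 0` with `u^N ≡ 1 mod 𝔪` for every unit `u`
(`(𝒪/𝔪)^*` is finite for `𝔪 ≠ 0`). [folklore] -/
theorem exists_even_pow_sub_one_mem {𝔪 : Ideal (𝓞 K)} (h𝔪 : 𝔪 ≠ ⊥) :
    ∃ N : ℕ, N ≠ 0 ∧ Even N ∧ ∀ u : (𝓞 K)ˣ, (u : 𝓞 K) ^ N - 1 ∈ 𝔪 := by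
  haveI : Finite (𝓞 K ⧸ 𝔪) := Ideal.finiteQuotientOfFreeOfNeBot 𝔪 h𝔪
  refine ⟨2 * Nat.card (𝓞 K ⧸ 𝔪)ˣ, mul_ne_zero two_ne_zero Nat.card_pos.ne', even_two_mul _, fun u ↦ ?_⟩
  rw [← Units.val_pow_eq_pow_val, ← unitsModHom_eq_one_iff, map_pow, pow_mul, pow_card_eq_one']


/-! ### The representatives `R_N = X ∩ box`, their ideals, and the fibres of `x ↦ x𝔟` -/

/-- **The representatives** of the narrow ray class of `𝔟 mod 𝔪` modulo `V = ⟨u_i^N⟩`: elements of `X(𝔪,𝔟)`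
with cone exponent in the box `[0,N)^{r-1}` (Neukirch's `ℜ` in the proof of VII (8.3), modulo `V`).
[cite: NeukirchANT1999, Ch. VII §8 proof of (8.3)] -/
def rayReps (𝔪 𝔟 : Ideal (𝓞 K)) (N : ℕ) : Set K :=
  {x | x ∈ rayElts 𝔪 𝔟 ∧ InConeBox N x}

section Reps

variable {𝔪 𝔟 : Ideal (𝓞 K)}

/-- Equal elements have equal ideals (proof-irrelevance helper). [folklore] -/
theorem rayEltIdeal_congr (h𝔟 : 𝔟 ≠ ⊥) {x x' : K} (hx : x - 1 ∈ rayModulus K 𝔪 𝔟)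
    (hx' : x' - 1 ∈ rayModulus K 𝔪 𝔟) (h : x = x') : rayEltIdeal h𝔟 hx = rayEltIdeal h𝔟 hx' := by
  subst h; rfl

/-- **The ideal `x𝔟` of a representative**, as an element of the narrow ray class of `𝔟`. [folklore] -/
def repIdeal (h𝔟 : 𝔟 ≠ ⊥) (hcop : IsCoprime 𝔟 𝔪) (N : ℕ) (x : rayReps 𝔪 𝔟 N) :
    {𝔞 : Ideal (𝓞 K) // RayClassRel 𝔪 𝔟 𝔞} :=
  ⟨rayEltIdeal h𝔟 x.2.1.2.1, rayClassRel_rayEltIdeal h𝔟 hcop x.2.1⟩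

/-- The box representative of an element of `X` is a representative. [folklore] -/
theorem boxRep_mem_rayReps (h𝔟 : 𝔟 ≠ ⊥) {N : ℕ} (hN0 : N ≠ 0) (hN : Even N)
    (hNm : ∀ i, ((fundSystem K i : (𝓞 K)ˣ) : 𝓞 K) ^ N - 1 ∈ 𝔪) {x : K} (hx : x ∈ rayElts 𝔪 𝔟) :
    boxRep K N x ∈ rayReps 𝔪 𝔟 N :=
  ⟨unit_mul_mem_rayElts h𝔟 (fundUnit_nsmul_mem_narrowRayUnits hN hNm _) hx, inConeBox_boxRep hN0 hx.1⟩

/-- The box representative has the same ideal. [folklore] -/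
theorem rayEltIdeal_boxRep (h𝔟 : 𝔟 ≠ ⊥) {N : ℕ} {x : K} (hx : x - 1 ∈ rayModulus K 𝔪 𝔟)
    (hx' : boxRep K N x - 1 ∈ rayModulus K 𝔪 𝔟) : rayEltIdeal h𝔟 hx' = rayEltIdeal h𝔟 hx :=
  rayEltIdeal_unit_mul h𝔟 _ hx hx'

/-- **Every ideal of the class is the ideal of a representative** (Neukirch VII (8.3):
`𝔎̂ ∩ 𝒪̂ = ⋃_ε εℜ`). [cite: NeukirchANT1999, Ch. VII §8 proof of (8.3)] -/
theorem repIdeal_surjective (h𝔟 : 𝔟 ≠ ⊥) (hcop : IsCoprime 𝔟 𝔪) {N : ℕ} (hN0 : N ≠ 0) (hN : Even N)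
    (hNm : ∀ i, ((fundSystem K i : (𝓞 K)ˣ) : 𝓞 K) ^ N - 1 ∈ 𝔪) :
    Function.Surjective (repIdeal h𝔟 hcop N) := by
  rintro ⟨𝔞, h𝔞⟩
  obtain ⟨x, hx, rfl⟩ := exists_rayElt_of_rayClassRel h𝔟 h𝔞
  exact ⟨⟨boxRep K N x, boxRep_mem_rayReps h𝔟 hN0 hN hNm hx⟩,
    Subtype.ext (rayEltIdeal_boxRep h𝔟 hx.2.1 (boxRep_mem_rayReps h𝔟 hN0 hN hNm hx).1.2.1)⟩

/-- **The fibres of `x ↦ x𝔟` on the representatives are all in bijection**: for ideals `𝔞₁ = x₁𝔟`,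
`𝔞₂ = x₂𝔟` of the class, `y ↦ boxRep (y x₂/x₁)` maps the representatives of `𝔞₁` bijectively onto those
of `𝔞₂` (`y = u x₁` with `u ∈ 𝒪_+^𝔪`, and `u x₂ ∈ X`). [folklore] -/
theorem nonempty_fibre_equiv (h𝔟 : 𝔟 ≠ ⊥) (hcop : IsCoprime 𝔟 𝔪) {N : ℕ} (hN0 : N ≠ 0) (hN : Even N)
    (hNm : ∀ i, ((fundSystem K i : (𝓞 K)ˣ) : 𝓞 K) ^ N - 1 ∈ 𝔪)
    (𝔞₁ 𝔞₂ : {𝔞 : Ideal (𝓞 K) // RayClassRel 𝔪 𝔟 𝔞}) :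
    Nonempty ((repIdeal h𝔟 hcop N ⁻¹' {𝔞₁}) ≃ (repIdeal h𝔟 hcop N ⁻¹' {𝔞₂})) := by
  obtain ⟨x₁, hx₁, h₁⟩ := exists_rayElt_of_rayClassRel h𝔟 𝔞₁.2
  obtain ⟨x₂, hx₂, h₂⟩ := exists_rayElt_of_rayClassRel h𝔟 𝔞₂.2
  -- transport between the fibres
  have key : ∀ {xa xb : K} (hxa : xa ∈ rayElts 𝔪 𝔟) (hxb : xb ∈ rayElts 𝔪 𝔟)
      (𝔞a 𝔞b : {𝔞 : Ideal (𝓞 K) // RayClassRel 𝔪 𝔟 𝔞})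
      (_ : rayEltIdeal h𝔟 hxa.2.1 = 𝔞a.1) (_ : rayEltIdeal h𝔟 hxb.2.1 = 𝔞b.1)
      (y : rayReps 𝔪 𝔟 N), repIdeal h𝔟 hcop N y = 𝔞a →
        ∃ u ∈ narrowRayUnits 𝔪, (y : K) * xb * xa⁻¹ = ((u : 𝓞 K) : K) * xb ∧ (y : K) = ((u : 𝓞 K) : K) * xa := by
    intro xa xb hxa hxb 𝔞a 𝔞b ha hb y hy
    have hyx : rayEltIdeal h𝔟 hxa.2.1 = rayEltIdeal h𝔟 y.2.1.2.1 := by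
      rw [ha]; exact (congrArg Subtype.val hy).symm
    obtain ⟨u, hu, hyu⟩ := exists_rayUnit_of_rayEltIdeal_eq h𝔟 hcop hxa y.2.1 hyx
    refine ⟨u, hu, ?_, hyu⟩
    rw [hyu]; field_simp [hxa.1]
  have mem : ∀ {xa xb : K} (hxa : xa ∈ rayElts 𝔪 𝔟) (hxb : xb ∈ rayElts 𝔪 𝔟)
      (𝔞a 𝔞b : {𝔞 : Ideal (𝓞 K) // RayClassRel 𝔪 𝔟 𝔞})
      (_ : rayEltIdeal h𝔟 hxa.2.1 = 𝔞a.1) (_ : rayEltIdeal h𝔟 hxb.2.1 = 𝔞b.1)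
      (y : rayReps 𝔪 𝔟 N), repIdeal h𝔟 hcop N y = 𝔞a → (y : K) * xb * xa⁻¹ ∈ rayElts 𝔪 𝔟 := by
    intro xa xb hxa hxb 𝔞a 𝔞b ha hb y hy
    obtain ⟨u, hu, heq, -⟩ := key hxa hxb 𝔞a 𝔞b ha hb y hy
    rw [heq]; exact unit_mul_mem_rayElts h𝔟 hu hxb
  -- the ideal of the transported representative
  have idl : ∀ {xa xb : K} (hxa : xa ∈ rayElts 𝔪 𝔟) (hxb : xb ∈ rayElts 𝔪 𝔟)
      (𝔞a 𝔞b : {𝔞 : Ideal (𝓞 K) // RayClassRel 𝔪 𝔟 𝔞})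
      (ha : rayEltIdeal h𝔟 hxa.2.1 = 𝔞a.1) (hb : rayEltIdeal h𝔟 hxb.2.1 = 𝔞b.1)
      (y : rayReps 𝔪 𝔟 N) (hy : repIdeal h𝔟 hcop N y = 𝔞a),
      repIdeal h𝔟 hcop N ⟨boxRep K N ((y : K) * xb * xa⁻¹),
        boxRep_mem_rayReps h𝔟 hN0 hN hNm (mem hxa hxb 𝔞a 𝔞b ha hb y hy)⟩ = 𝔞b := by
    intro xa xb hxa hxb 𝔞a 𝔞b ha hb y hy
    have hmem := mem hxa hxb 𝔞a 𝔞b ha hb y hy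
    obtain ⟨u, hu, heq, -⟩ := key hxa hxb 𝔞a 𝔞b ha hb y hy
    refine Subtype.ext ?_
    show rayEltIdeal h𝔟 (boxRep_mem_rayReps h𝔟 hN0 hN hNm hmem).1.2.1 = 𝔞b.1
    rw [rayEltIdeal_boxRep h𝔟 hmem.2.1, ← hb]
    have hux : ((u : 𝓞 K) : K) * xb - 1 ∈ rayModulus K 𝔪 𝔟 := (unit_mul_mem_rayElts h𝔟 hu hxb).2.1
    rw [rayEltIdeal_congr h𝔟 hmem.2.1 hux heq, rayEltIdeal_unit_mul h𝔟 u hxb.2.1 hux]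
  -- round trip
  have round : ∀ {xa xb : K} (_ : xa ∈ rayElts 𝔪 𝔟) (_ : xb ∈ rayElts 𝔪 𝔟)
      (y : rayReps 𝔪 𝔟 N), boxRep K N (boxRep K N ((y : K) * xb * xa⁻¹) * xa * xb⁻¹) = (y : K) := by
    intro xa xb hxa hxb y
    obtain ⟨q, hq⟩ := boxRep_eq_fundUnit_mul (K := K) N ((y : K) * xb * xa⁻¹)
    have : boxRep K N ((y : K) * xb * xa⁻¹) * xa * xb⁻¹ = (NumberField.fundUnit K (N • q) : K) * (y : K) := by
      rw [hq]; field_simp [hxa.1, hxb.1]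
    rw [this, boxRep_fundUnit_nsmul_mul hN0 y.2.1.1, boxRep_eq_self y.2.2]
  exact ⟨{ toFun := fun y ↦ ⟨⟨boxRep K N ((y.1 : K) * x₂ * x₁⁻¹),
               boxRep_mem_rayReps h𝔟 hN0 hN hNm (mem hx₁ hx₂ 𝔞₁ 𝔞₂ h₁ h₂ y.1 y.2)⟩,
               idl hx₁ hx₂ 𝔞₁ 𝔞₂ h₁ h₂ y.1 y.2⟩,
           invFun := fun y ↦ ⟨⟨boxRep K N ((y.1 : K) * x₁ * x₂⁻¹),
               boxRep_mem_rayReps h𝔟 hN0 hN hNm (mem hx₂ hx₁ 𝔞₂ 𝔞₁ h₂ h₁ y.1 y.2)⟩,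
               idl hx₂ hx₁ 𝔞₂ 𝔞₁ h₂ h₁ y.1 y.2⟩,
           left_inv := fun y ↦ Subtype.ext (Subtype.ext (round hx₁ hx₂ y.1)),
           right_inv := fun y ↦ Subtype.ext (Subtype.ext (round hx₂ hx₁ y.1)) }⟩

/-- **The norm of `x𝔟`**: `𝔑(x𝔟) = |N(x)| 𝔑(𝔟)` (Mathlib `FractionalIdeal.absNorm`). [folklore] -/
theorem absNorm_rayEltIdeal (h𝔟 : 𝔟 ≠ ⊥) {x : K} (hx : x - 1 ∈ rayModulus K 𝔪 𝔟) :
    (Ideal.absNorm (rayEltIdeal h𝔟 hx) : ℚ) = |Algebra.norm ℚ x| * Ideal.absNorm 𝔟 := by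
  have := congrArg FractionalIdeal.absNorm (coe_rayEltIdeal h𝔟 hx)
  rwa [map_mul, FractionalIdeal.coeIdeal_absNorm, FractionalIdeal.coeIdeal_absNorm,
    FractionalIdeal.absNorm_span_singleton] at this

/-- The norm of a representative of the ideal `𝔞` is `𝔑(𝔞)/𝔑(𝔟)` (as a real number). [folklore] -/
theorem abs_norm_eq_of_repIdeal_eq (h𝔟 : 𝔟 ≠ ⊥) (hcop : IsCoprime 𝔟 𝔪) {N : ℕ} (x : rayReps 𝔪 𝔟 N)
    (𝔞 : {𝔞 : Ideal (𝓞 K) // RayClassRel 𝔪 𝔟 𝔞}) (h : repIdeal h𝔟 hcop N x = 𝔞) :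
    (|(Algebra.norm ℚ (x : K) : ℚ)| : ℝ) = (Ideal.absNorm 𝔞.1 : ℝ) / (Ideal.absNorm 𝔟 : ℝ) := by
  have h𝔟pos : (0 : ℝ) < Ideal.absNorm 𝔟 := by
    exact_mod_cast Nat.pos_of_ne_zero (by rwa [ne_eq, Ideal.absNorm_eq_zero_iff])
  have hq := absNorm_rayEltIdeal h𝔟 x.2.1.2.1
  have hq' : (Ideal.absNorm 𝔞.1 : ℚ) = |Algebra.norm ℚ (x : K)| * Ideal.absNorm 𝔟 := by
    rw [← hq, ← h]; rfl
  rw [eq_div_iff h𝔟pos.ne', ← Rat.cast_abs]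
  exact_mod_cast hq'.symm

/-- **The representatives inject into the piece `(∅, +1)` of the coset `1 + 𝔪𝔟⁻¹`**, whose norm series
converges (`HeckePieceDirichlet.lean`). [folklore] -/
theorem rayReps_subset_pieceReps (𝔪 𝔟 : Ideal (𝓞 K)) (N : ℕ) :
    rayReps 𝔪 𝔟 N ⊆ NumberField.pieceReps K ∅ 1 (rayModulus K 𝔪 𝔟) 1 N := by
  intro x hx
  refine ⟨hx.1.2.1, ⟨hx.1.1, ?_⟩, hx.2⟩
  simp [NumberField.realPow]

/-- Summability of `|N(x)|^{-σ}` over the representatives for `σ > 1`. [folklore] -/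
theorem summable_rayReps_norm_rpow (𝔪 𝔟 : Ideal (𝓞 K)) (N : ℕ) {σ : ℝ} (hσ : 1 < σ) :
    Summable fun x : rayReps 𝔪 𝔟 N ↦ (|(Algebra.norm ℚ (x : K) : ℚ)| : ℝ) ^ (-σ) := by
  have hinj : Function.Injective (Set.inclusion (rayReps_subset_pieceReps 𝔪 𝔟 N)) :=
    Set.inclusion_injective _
  have hmain := NumberField.summable_pieceReps_norm_rpow (K := K) ∅ 1 (rayModulus K 𝔪 𝔟) 1 N hσ
  have h2 := hmain.comp_injective hinj
  exact h2

/-- **The fibres are finite**: the representatives of a fixed ideal `𝔞` all have norm `𝔑(𝔞)/𝔑(𝔟)`, and a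
summable family of positive terms takes each positive value only finitely often. [folklore] -/
theorem finite_fibre (h𝔟 : 𝔟 ≠ ⊥) (hcop : IsCoprime 𝔟 𝔪) (N : ℕ)
    (𝔞 : {𝔞 : Ideal (𝓞 K) // RayClassRel 𝔪 𝔟 𝔞}) : Finite (repIdeal h𝔟 hcop N ⁻¹' {𝔞}) := by
  have hsum := summable_rayReps_norm_rpow 𝔪 𝔟 N (σ := 2) one_lt_two
  set g : rayReps 𝔪 𝔟 N → ℝ := fun x ↦ (|(Algebra.norm ℚ (x : K) : ℚ)| : ℝ) ^ (-(2 : ℝ)) with hg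
  set c : ℝ := (Ideal.absNorm 𝔞.1 : ℝ) / (Ideal.absNorm 𝔟 : ℝ) with hc
  have h𝔞0 : 𝔞.1 ≠ ⊥ := (𝔞.2.ne_bot_iff).mpr h𝔟
  have hcpos : 0 < c := by
    have h1 : (0 : ℝ) < Ideal.absNorm 𝔞.1 := by
      exact_mod_cast Nat.pos_of_ne_zero (by rw [ne_eq, Ideal.absNorm_eq_zero_iff]; exact h𝔞0)
    have h2 : (0 : ℝ) < Ideal.absNorm 𝔟 := by
      exact_mod_cast Nat.pos_of_ne_zero (by rwa [ne_eq, Ideal.absNorm_eq_zero_iff])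
    positivity
  have hg0 : 0 < c ^ (-(2 : ℝ)) := Real.rpow_pos_of_pos hcpos _
  have hev := (hsum.tendsto_cofinite_zero.eventually (gt_mem_nhds hg0))
  have hfin : {x : rayReps 𝔪 𝔟 N | ¬ g x < c ^ (-(2 : ℝ))}.Finite := Filter.eventually_cofinite.mp hev
  refine (hfin.subset fun x hx ↦ ?_).to_subtype
  have hx' : repIdeal h𝔟 hcop N x = 𝔞 := hx
  simp only [Set.mem_setOf_eq, hg, abs_norm_eq_of_repIdeal_eq h𝔟 hcop x 𝔞 hx', ← hc, lt_self_iff_false,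
    not_false_eq_true]

/-- **The multiplicity** `h = h(𝔪, 𝔟, N)`: the number of representatives of the ideal `𝔟` itself, i.e. of
box representatives of the units `𝒪_+^𝔪` — the index `(𝒪_+^𝔪 : V)`. [folklore] -/
def rayMult (h𝔟 : 𝔟 ≠ ⊥) (hcop : IsCoprime 𝔟 𝔪) (N : ℕ) : ℕ :=
  Nat.card (repIdeal h𝔟 hcop N ⁻¹' {⟨𝔟, RayClassRel.refl 𝔪 𝔟⟩})

/-- Every fibre has `h` elements. [folklore] -/
theorem natCard_fibre (h𝔟 : 𝔟 ≠ ⊥) (hcop : IsCoprime 𝔟 𝔪) {N : ℕ} (hN0 : N ≠ 0) (hN : Even N)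
    (hNm : ∀ i, ((fundSystem K i : (𝓞 K)ˣ) : 𝓞 K) ^ N - 1 ∈ 𝔪)
    (𝔞 : {𝔞 : Ideal (𝓞 K) // RayClassRel 𝔪 𝔟 𝔞}) :
    Nat.card (repIdeal h𝔟 hcop N ⁻¹' {𝔞}) = rayMult h𝔟 hcop N :=
  Nat.card_congr (nonempty_fibre_equiv h𝔟 hcop hN0 hN hNm 𝔞 _).some

/-- `h ≠ 0` (the fibres are nonempty and finite). [folklore] -/
theorem rayMult_ne_zero (h𝔟 : 𝔟 ≠ ⊥) (hcop : IsCoprime 𝔟 𝔪) {N : ℕ} (hN0 : N ≠ 0) (hN : Even N)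
    (hNm : ∀ i, ((fundSystem K i : (𝓞 K)ˣ) : 𝓞 K) ^ N - 1 ∈ 𝔪) : rayMult h𝔟 hcop N ≠ 0 := by
  rw [rayMult]
  haveI := finite_fibre h𝔟 hcop N (⟨𝔟, RayClassRel.refl 𝔪 𝔟⟩ : {𝔞 : Ideal (𝓞 K) // RayClassRel 𝔪 𝔟 𝔞})
  obtain ⟨x, hx⟩ := repIdeal_surjective h𝔟 hcop hN0 hN hNm ⟨𝔟, RayClassRel.refl 𝔪 𝔟⟩
  exact Nat.card_ne_zero.mpr ⟨⟨⟨x, hx⟩⟩, inferInstance⟩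

/-- **Regrouping a sum over the representatives along `x ↦ x𝔟`**: for a summable family depending only
on the ideal, `Σ_{x ∈ R_N} G(x𝔟) = h · Σ_{𝔞 ∈ class} G(𝔞)` (each ideal of the class is hit exactly `h`
times) — the passage `Σ_{a ∈ ℜ} |N(a)|^{-s} ↔ Σ_{𝔞 ∈ 𝔎} 𝔑(𝔞)^{-s}` of Neukirch VII (5.4)/(8.3), here with the
finite multiplicity `h = (𝒪_+^𝔪 : V)`. [cite: NeukirchANT1999, Ch. VII §5 (5.4)] -/
theorem tsum_rayReps_eq_rayMult_mul_tsum (h𝔟 : 𝔟 ≠ ⊥) (hcop : IsCoprime 𝔟 𝔪) {N : ℕ} (hN0 : N ≠ 0) (hN : Even N)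
    (hNm : ∀ i, ((fundSystem K i : (𝓞 K)ˣ) : 𝓞 K) ^ N - 1 ∈ 𝔪)
    (G : {𝔞 : Ideal (𝓞 K) // RayClassRel 𝔪 𝔟 𝔞} → ℂ)
    (hsum : Summable fun x : rayReps 𝔪 𝔟 N ↦ G (repIdeal h𝔟 hcop N x)) :
    ∑' x : rayReps 𝔪 𝔟 N, G (repIdeal h𝔟 hcop N x) = (rayMult h𝔟 hcop N : ℂ) * ∑' 𝔞, G 𝔞 := by
  have hfib := hsum.hasSum.tsum_fiberwise (repIdeal h𝔟 hcop N)
  have hinner : ∀ 𝔞 : {𝔞 : Ideal (𝓞 K) // RayClassRel 𝔪 𝔟 𝔞},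
      (∑' b : (repIdeal h𝔟 hcop N ⁻¹' {𝔞}), G (repIdeal h𝔟 hcop N b)) = (rayMult h𝔟 hcop N : ℂ) * G 𝔞 := by
    intro 𝔞
    have h1 : ∀ b : (repIdeal h𝔟 hcop N ⁻¹' {𝔞}), G (repIdeal h𝔟 hcop N b) = G 𝔞 := fun b ↦ by
      have : repIdeal h𝔟 hcop N b.1 = 𝔞 := b.2
      rw [this]
    rw [tsum_congr h1, tsum_const, natCard_fibre h𝔟 hcop hN0 hN hNm 𝔞, nsmul_eq_mul]
  simp only [hinner] at hfib
  rw [hfib.tsum_eq.symm, tsum_mul_left]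

end Reps


/-! ### Total positivity via the real places, and the sign characters -/

omit [NumberField K] in
/-- **Total positivity at the real embeddings is positivity at the real places** (every `φ : K →+* ℝ`
is the embedding of the real place it defines). [folklore] -/
theorem forall_ringHom_pos_iff_mixedEmbedding (x : K) :
    (∀ φ : K →+* ℝ, 0 < φ x) ↔
      ∀ w : {w : NumberField.InfinitePlace K // w.IsReal}, 0 < (NumberField.mixedEmbedding K x).1 w := by
  constructor
  · intro h w
    rw [NumberField.mixedEmbedding.mixedEmbedding_apply_isReal]
    exact h _
  · intro h φ
    set ψ : K →+* ℂ := (algebraMap ℝ ℂ).comp φ with hψ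
    have hψr : NumberField.ComplexEmbedding.IsReal ψ := by
      rw [NumberField.ComplexEmbedding.isReal_iff]
      ext y
      simp [hψ, NumberField.ComplexEmbedding.conjugate]
    have hw : IsReal (NumberField.InfinitePlace.mk ψ) := NumberField.InfinitePlace.isReal_mk_iff.mpr hψr
    have key := h ⟨NumberField.InfinitePlace.mk ψ, hw⟩
    rw [NumberField.mixedEmbedding.mixedEmbedding_apply_isReal] at key
    have heq : ((embedding_of_isReal hw x : ℝ) : ℂ) = ((φ x : ℝ) : ℂ) := by
      rw [NumberField.InfinitePlace.embedding_of_isReal_apply,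
        NumberField.InfinitePlace.embedding_mk_eq_of_isReal hψr, hψ]
      rfl
    rwa [Complex.ofReal_injective heq] at key

omit [NumberField K] in
/-- `sgn N(x^p) = ∏_{τ ∈ p} sgn x_τ` as complex numbers. [folklore] -/
theorem cast_sign_realPow (p : Finset {w : NumberField.InfinitePlace K // w.IsReal}) (x : K) :
    ((SignType.sign (NumberField.realPow K p x) : SignType) : ℂ) =
      ∏ w ∈ p, ((SignType.sign ((NumberField.mixedEmbedding K x).1 w) : SignType) : ℂ) := by
  have h1 : SignType.sign (∏ w ∈ p, (NumberField.mixedEmbedding K x).1 w) =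
      ∏ w ∈ p, SignType.sign ((NumberField.mixedEmbedding K x).1 w) := map_prod (signHom (α := ℝ)) _ p
  rw [NumberField.realPow, h1]
  exact map_prod (SignType.castHom (α := ℂ)) _ p


/-- **The sign characters separate the totally positive elements**: for `x ≠ 0`,
`Σ_{p ⊆ {real places}} sgn N(x^p) = ∏_τ (1 + sgn x_τ) = 2^{r₁} 𝟙[x ≫ 0]` (finite Fourier inversion on
`{±1}^{r₁}`; the characters `N((x/|x|)^p)` are the `χ_∞` of the Dirichlet characters `mod 𝔪`, Neukirch VII (6.9)).
[cite: NeukirchANT1999, Ch. VII §6 (6.9) Proposition] -/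
theorem sum_cast_sign_realPow {x : K} (hx : x ≠ 0) :
    ∑ p : Finset {w : NumberField.InfinitePlace K // w.IsReal}, ((SignType.sign (NumberField.realPow K p x) : SignType) : ℂ) =
      if ∀ w : {w : NumberField.InfinitePlace K // w.IsReal}, 0 < (NumberField.mixedEmbedding K x).1 w
        then 2 ^ Fintype.card {w : NumberField.InfinitePlace K // w.IsReal} else 0 := by
  set sg : {w : NumberField.InfinitePlace K // w.IsReal} → ℂ := fun w ↦
    ((SignType.sign ((NumberField.mixedEmbedding K x).1 w) : SignType) : ℂ) with hsg
  have hsum : ∑ p : Finset {w : NumberField.InfinitePlace K // w.IsReal},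
      ((SignType.sign (NumberField.realPow K p x) : SignType) : ℂ) = ∏ w, (sg w + 1) := by
    rw [Finset.prod_add, Finset.powerset_univ]
    refine Finset.sum_congr rfl fun p _ ↦ ?_
    rw [Finset.prod_const_one, mul_one, cast_sign_realPow]
  rw [hsum]
  have hne : ∀ w : {w : NumberField.InfinitePlace K // w.IsReal}, (NumberField.mixedEmbedding K x).1 w ≠ 0 := fun w ↦ by
    rw [NumberField.mixedEmbedding.mixedEmbedding_apply_isReal]; exact (map_ne_zero _).mpr hx
  split_ifs with hpos
  · have : ∀ w, sg w + 1 = 2 := fun w ↦ by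
      rw [hsg]; simp only; rw [sign_pos (hpos w)]; norm_num
    simp only [this, Finset.prod_const, Finset.card_univ]
  · obtain ⟨w, hw⟩ := not_forall.mp hpos
    have hneg : (NumberField.mixedEmbedding K x).1 w < 0 := lt_of_le_of_ne (not_lt.mp hw) (hne w)
    refine Finset.prod_eq_zero (Finset.mem_univ w) ?_
    rw [hsg]; simp only; rw [sign_neg hneg]; norm_num

/-! ### The signed coset series and the sum over the representatives -/

section Assembly

variable {𝔪 𝔟 : Ideal (𝓞 K)}

/-- Membership in `pieceReps` unfolded. [folklore] -/
theorem mem_pieceReps_iff (p : Finset {w : NumberField.InfinitePlace K // w.IsReal}) (ς : SignType)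
    (I : FractionalIdeal (𝓞 K)⁰ K) (a₀ : K) (N : ℕ) (x : K) :
    x ∈ NumberField.pieceReps K p ς I a₀ N ↔
      x - a₀ ∈ I ∧ (x ≠ 0 ∧ SignType.sign (NumberField.realPow K p x) = ς) ∧ InConeBox N x :=
  Iff.rfl

/-- **One sign character, as a series over the whole piece `(∅,+1)`**: for `re s > 1`,
`D_{p,+}(s) - D_{p,-}(s) = Σ_{x ∈ Y_N} sgn N(x^p) |N(x)|^{-s}`, `Y_N = {x ≡ 1 mod 𝔪𝔟⁻¹, x ≠ 0, box}`. [folklore] -/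
theorem pieceDirichlet_sub_eq_tsum_indicator (𝔪 𝔟 : Ideal (𝓞 K)) (p : Finset {w : NumberField.InfinitePlace K // w.IsReal})
    (N : ℕ) {s : ℂ} (hs : 1 < s.re) :
    NumberField.pieceDirichlet K p 1 (rayModulus K 𝔪 𝔟) 1 N s -
        NumberField.pieceDirichlet K p (-1) (rayModulus K 𝔪 𝔟) 1 N s =
      ∑' x : K, (NumberField.pieceReps K ∅ 1 (rayModulus K 𝔪 𝔟) 1 N).indicator
        (fun x ↦ ((SignType.sign (NumberField.realPow K p x) : SignType) : ℂ) *
          (((|(Algebra.norm ℚ x : ℚ)| : ℝ)) : ℂ) ^ (-s)) x := by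
  set I := rayModulus K 𝔪 𝔟 with hI
  set g : K → ℂ := fun x ↦ (((|(Algebra.norm ℚ x : ℚ)| : ℝ)) : ℂ) ^ (-s) with hg
  have hD : ∀ ς : SignType, NumberField.pieceDirichlet K p ς I 1 N s =
      ∑' x : K, (NumberField.pieceReps K p ς I 1 N).indicator g x := fun ς ↦ by
    rw [NumberField.pieceDirichlet, ← tsum_subtype]
  have hS : ∀ ς : SignType, Summable ((NumberField.pieceReps K p ς I 1 N).indicator g) := fun ς ↦
    summable_subtype_iff_indicator.mp (NumberField.summable_norm_pieceDirichlet_term p ς I 1 N hs).of_norm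
  rw [hD, hD, ← (hS 1).tsum_sub (hS (-1))]
  refine tsum_congr fun x ↦ ?_
  by_cases hY : x ∈ NumberField.pieceReps K ∅ 1 I 1 N
  · obtain ⟨hx1, ⟨hx0, -⟩, hbox⟩ := hY
    rw [Set.indicator_of_mem (show x ∈ NumberField.pieceReps K ∅ 1 I 1 N from ⟨hx1, ⟨hx0, by simp [NumberField.realPow]⟩, hbox⟩)]
    rcases lt_or_gt_of_ne (NumberField.realPow_ne_zero p hx0) with hneg | hposx
    · have h1 : x ∉ NumberField.pieceReps K p 1 I 1 N := fun h ↦ by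
        have := h.2.1.2; rw [sign_neg hneg] at this; exact absurd this (by decide)
      have h2 : x ∈ NumberField.pieceReps K p (-1) I 1 N := ⟨hx1, ⟨hx0, sign_neg hneg⟩, hbox⟩
      rw [Set.indicator_of_notMem h1, Set.indicator_of_mem h2, sign_neg hneg]
      simp [hg]
    · have h1 : x ∈ NumberField.pieceReps K p 1 I 1 N := ⟨hx1, ⟨hx0, sign_pos hposx⟩, hbox⟩
      have h2 : x ∉ NumberField.pieceReps K p (-1) I 1 N := fun h ↦ by
        have := h.2.1.2; rw [sign_pos hposx] at this; exact absurd this (by decide)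
      rw [Set.indicator_of_mem h1, Set.indicator_of_notMem h2, sign_pos hposx]
      simp [hg]
  · have h1 : x ∉ NumberField.pieceReps K p 1 I 1 N := fun h ↦ hY ⟨h.1, ⟨h.2.1.1, by simp [NumberField.realPow]⟩, h.2.2⟩
    have h2 : x ∉ NumberField.pieceReps K p (-1) I 1 N := fun h ↦ hY ⟨h.1, ⟨h.2.1.1, by simp [NumberField.realPow]⟩, h.2.2⟩
    rw [Set.indicator_of_notMem h1, Set.indicator_of_notMem h2, Set.indicator_of_notMem hY, sub_zero]

/-- The representatives are the totally positive elements of the piece `(∅,+1)`. [folklore] -/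
theorem mem_rayReps_iff (𝔪 𝔟 : Ideal (𝓞 K)) (N : ℕ) (x : K) :
    x ∈ rayReps 𝔪 𝔟 N ↔ x ∈ NumberField.pieceReps K ∅ 1 (rayModulus K 𝔪 𝔟) 1 N ∧
      ∀ w : {w : NumberField.InfinitePlace K // w.IsReal}, 0 < (NumberField.mixedEmbedding K x).1 w := by
  rw [← forall_ringHom_pos_iff_mixedEmbedding]
  constructor
  · intro h; exact ⟨rayReps_subset_pieceReps 𝔪 𝔟 N h, h.1.2.2⟩
  · rintro ⟨⟨hx1, ⟨hx0, -⟩, hbox⟩, hpos⟩; exact ⟨⟨hx0, hx1, hpos⟩, hbox⟩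

/-- **Summing the sign characters isolates the representatives**: for `re s > 1`,
`Σ_p (D_{p,+}(s) - D_{p,-}(s)) = 2^{r₁} Σ_{x ∈ R_N} |N(x)|^{-s}`. [cite: NeukirchANT1999, Ch. VII §6 (6.9) Proposition] -/
theorem sum_pieceDirichlet_sub_eq (𝔪 𝔟 : Ideal (𝓞 K)) (N : ℕ) {s : ℂ} (hs : 1 < s.re) :
    ∑ p : Finset {w : NumberField.InfinitePlace K // w.IsReal},
        (NumberField.pieceDirichlet K p 1 (rayModulus K 𝔪 𝔟) 1 N s -
          NumberField.pieceDirichlet K p (-1) (rayModulus K 𝔪 𝔟) 1 N s) =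
      (2 : ℂ) ^ Fintype.card {w : NumberField.InfinitePlace K // w.IsReal} *
        ∑' x : rayReps 𝔪 𝔟 N, (((|(Algebra.norm ℚ (x : K) : ℚ)| : ℝ)) : ℂ) ^ (-s) := by
  set I := rayModulus K 𝔪 𝔟 with hI
  set Y := NumberField.pieceReps K ∅ 1 I 1 N with hY
  set g : K → ℂ := fun x ↦ (((|(Algebra.norm ℚ x : ℚ)| : ℝ)) : ℂ) ^ (-s) with hg
  set sgn : Finset {w : NumberField.InfinitePlace K // w.IsReal} → K → ℂ := fun p x ↦
    ((SignType.sign (NumberField.realPow K p x) : SignType) : ℂ) with hsgn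
  -- summability of the signed indicator families
  have hgn : Summable (Y.indicator fun x ↦ ‖g x‖) :=
    summable_subtype_iff_indicator.mp (NumberField.summable_norm_pieceDirichlet_term ∅ 1 I 1 N hs)
  have hsgn1 : ∀ p x, ‖sgn p x‖ ≤ 1 := fun p x ↦ by
    rw [hsgn]; simp only
    rcases SignType.sign (NumberField.realPow K p x) with _ | _ | _ <;> simp
  have hSp : ∀ p, Summable (Y.indicator fun x ↦ sgn p x * g x) := fun p ↦ by
    refine Summable.of_norm_bounded hgn fun x ↦ ?_
    by_cases hx : x ∈ Y
    · rw [Set.indicator_of_mem hx, Set.indicator_of_mem hx, norm_mul]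
      exact mul_le_of_le_one_left (norm_nonneg _) (hsgn1 p x)
    · rw [Set.indicator_of_notMem hx, Set.indicator_of_notMem hx, norm_zero]
  calc ∑ p : Finset {w : NumberField.InfinitePlace K // w.IsReal},
        (NumberField.pieceDirichlet K p 1 I 1 N s - NumberField.pieceDirichlet K p (-1) I 1 N s)
      = ∑ p : Finset {w : NumberField.InfinitePlace K // w.IsReal}, ∑' x : K, Y.indicator (fun x ↦ sgn p x * g x) x :=
        Finset.sum_congr rfl fun p _ ↦ pieceDirichlet_sub_eq_tsum_indicator 𝔪 𝔟 p N hs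
    _ = ∑' x : K, ∑ p : Finset {w : NumberField.InfinitePlace K // w.IsReal}, Y.indicator (fun x ↦ sgn p x * g x) x :=
        (Summable.tsum_finsetSum fun p _ ↦ hSp p).symm
    _ = ∑' x : K, (2 : ℂ) ^ Fintype.card {w : NumberField.InfinitePlace K // w.IsReal} * (rayReps 𝔪 𝔟 N).indicator g x := by
        refine tsum_congr fun x ↦ ?_
        by_cases hx : x ∈ Y
        · simp only [Set.indicator_of_mem hx]
          rw [← Finset.sum_mul, sum_cast_sign_realPow hx.2.1.1]
          by_cases hpos : ∀ w : {w : NumberField.InfinitePlace K // w.IsReal}, 0 < (NumberField.mixedEmbedding K x).1 w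
          · rw [if_pos hpos, Set.indicator_of_mem ((mem_rayReps_iff 𝔪 𝔟 N x).mpr ⟨hx, hpos⟩)]
          · rw [if_neg hpos, Set.indicator_of_notMem (fun h ↦ hpos ((mem_rayReps_iff 𝔪 𝔟 N x).mp h).2),
              zero_mul, mul_zero]
        · simp only [Set.indicator_of_notMem hx, Finset.sum_const_zero]
          rw [Set.indicator_of_notMem (fun h ↦ hx ((mem_rayReps_iff 𝔪 𝔟 N x).mp h).1), mul_zero]
    _ = (2 : ℂ) ^ Fintype.card {w : NumberField.InfinitePlace K // w.IsReal} *
          ∑' x : rayReps 𝔪 𝔟 N, g x := by rw [tsum_mul_left, tsum_subtype]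

/-- `(a/b)^{-z} = a^{-z} b^{z}` for `a ≥ 0`, `b > 0` real and complex `z` (a private copy of the 4-line
`MellinBarnes.div_ofReal_cpow_neg` of `InvZetaMellinBarnes.lean`, which this file must not import). [folklore] -/
private theorem ofReal_div_cpow_neg {a b : ℝ} (ha : 0 ≤ a) (hb : 0 < b) (z : ℂ) :
    ((a / b : ℝ) : ℂ) ^ (-z) = (a : ℂ) ^ (-z) * (b : ℂ) ^ z := by
  rw [div_eq_mul_inv, Complex.ofReal_mul, Complex.mul_cpow_ofReal_nonneg ha (inv_nonneg.mpr hb.le),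
    Complex.ofReal_inv, Complex.inv_cpow _ _ (by rw [Complex.arg_ofReal_of_nonneg hb.le]; exact Real.pi_ne_zero.symm),
    Complex.cpow_neg, Complex.cpow_neg, inv_inv]

/-- The partial zeta function as a sum over the class (subtype form). [folklore] -/
theorem rayClassPartialZeta_eq_tsum_subtype (𝔪 𝔟 : Ideal (𝓞 K)) (s : ℂ) :
    rayClassPartialZeta 𝔪 𝔟 s =
      ∑' 𝔞 : {𝔞 : Ideal (𝓞 K) // RayClassRel 𝔪 𝔟 𝔞}, ((Ideal.absNorm 𝔞.1 : ℕ) : ℂ) ^ (-s) := by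
  rw [rayClassPartialZeta,
    show (∑' 𝔞 : {𝔞 : Ideal (𝓞 K) // RayClassRel 𝔪 𝔟 𝔞}, ((Ideal.absNorm 𝔞.1 : ℕ) : ℂ) ^ (-s)) =
      ∑' 𝔞 : Ideal (𝓞 K), {𝔞 : Ideal (𝓞 K) | RayClassRel 𝔪 𝔟 𝔞}.indicator
        (fun 𝔞 ↦ ((Ideal.absNorm 𝔞 : ℕ) : ℂ) ^ (-s)) 𝔞 from
      tsum_subtype {𝔞 : Ideal (𝓞 K) | RayClassRel 𝔪 𝔟 𝔞} (fun 𝔞 ↦ ((Ideal.absNorm 𝔞 : ℕ) : ℂ) ^ (-s))]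
  refine tsum_congr fun 𝔞 ↦ ?_
  simp only [rayClassPartialZetaSummand, Set.indicator_apply, Set.mem_setOf_eq]

/-- **The partial zeta function of a narrow ray class as a sum of signed coset series**
(Neukirch VII §8 Remark 1 with (5.3)–(5.4), (6.9) and the proof of (8.3)): for `𝔟 ≠ 0` prime to `𝔪`,
`N` even, `N ≠ 0`, with `u_i^N ≡ 1 mod 𝔪`, and `re s > 1`,
`Z_𝔪(𝔟, s) = h⁻¹ · 2^{-r₁} · 𝔑(𝔟)^{-s} · Σ_{p ⊆ {real places}} (D_{p,+}(s) - D_{p,-}(s))`,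
where `D_{p,ς}(s) = Σ_{x ∈ pieceReps K p ς (𝔪𝔟⁻¹) 1 N} |N(x)|^{-s}` (`HeckePieceDirichlet.pieceDirichlet`) and
`h = rayMult` is the number of representatives of each ideal of the class.
[cite: NeukirchANT1999, Ch. VII §8 Remark 1 (after (8.6)) and proof of (8.3)] -/
theorem rayClassPartialZeta_eq_sum_pieceDirichlet (h𝔟 : 𝔟 ≠ ⊥) (hcop : IsCoprime 𝔟 𝔪) {N : ℕ} (hN0 : N ≠ 0)
    (hN : Even N) (hNm : ∀ i, ((fundSystem K i : (𝓞 K)ˣ) : 𝓞 K) ^ N - 1 ∈ 𝔪) {s : ℂ} (hs : 1 < s.re) :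
    rayClassPartialZeta 𝔪 𝔟 s =
      ((rayMult h𝔟 hcop N : ℂ))⁻¹ * ((2 : ℂ) ^ Fintype.card {w : NumberField.InfinitePlace K // w.IsReal})⁻¹ *
        ((Ideal.absNorm 𝔟 : ℕ) : ℂ) ^ (-s) *
        ∑ p : Finset {w : NumberField.InfinitePlace K // w.IsReal},
          (NumberField.pieceDirichlet K p 1 (rayModulus K 𝔪 𝔟) 1 N s -
            NumberField.pieceDirichlet K p (-1) (rayModulus K 𝔪 𝔟) 1 N s) := by
  set G : {𝔞 : Ideal (𝓞 K) // RayClassRel 𝔪 𝔟 𝔞} → ℂ := fun 𝔞 ↦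
    (((Ideal.absNorm 𝔞.1 : ℝ) / (Ideal.absNorm 𝔟 : ℝ) : ℝ) : ℂ) ^ (-s) with hG
  have h𝔟pos : (0 : ℝ) < Ideal.absNorm 𝔟 := by
    exact_mod_cast Nat.pos_of_ne_zero (by rwa [ne_eq, Ideal.absNorm_eq_zero_iff])
  -- the sum over the representatives, as a sum over the class
  have hterm : ∀ x : rayReps 𝔪 𝔟 N,
      (((|(Algebra.norm ℚ (x : K) : ℚ)| : ℝ)) : ℂ) ^ (-s) = G (repIdeal h𝔟 hcop N x) := fun x ↦ by
    rw [hG]; simp only; rw [abs_norm_eq_of_repIdeal_eq h𝔟 hcop x _ rfl]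
  have hsumR : Summable fun x : rayReps 𝔪 𝔟 N ↦ (((|(Algebra.norm ℚ (x : K) : ℚ)| : ℝ)) : ℂ) ^ (-s) := by
    refine Summable.of_norm ((summable_rayReps_norm_rpow 𝔪 𝔟 N hs).congr fun x ↦ ?_)
    have hpos : (0 : ℝ) < (|(Algebra.norm ℚ (x : K) : ℚ)| : ℝ) := by
      rw [← Rat.cast_abs]; exact_mod_cast abs_pos.mpr (Algebra.norm_ne_zero_iff.mpr x.2.1.1)
    rw [Complex.norm_cpow_eq_rpow_re_of_pos hpos, Complex.neg_re]
  have h1 : ∑' x : rayReps 𝔪 𝔟 N, (((|(Algebra.norm ℚ (x : K) : ℚ)| : ℝ)) : ℂ) ^ (-s) =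
      (rayMult h𝔟 hcop N : ℂ) * ∑' 𝔞, G 𝔞 := by
    rw [tsum_congr hterm]
    exact tsum_rayReps_eq_rayMult_mul_tsum h𝔟 hcop hN0 hN hNm G (hsumR.congr hterm)
  -- the sum over the class is `𝔑(𝔟)^s Z`
  have h2 : ∑' 𝔞, G 𝔞 = ((Ideal.absNorm 𝔟 : ℕ) : ℂ) ^ s * rayClassPartialZeta 𝔪 𝔟 s := by
    rw [rayClassPartialZeta_eq_tsum_subtype, ← tsum_mul_left]
    refine tsum_congr fun 𝔞 ↦ ?_
    rw [hG]; simp only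
    rw [ofReal_div_cpow_neg (Nat.cast_nonneg _) h𝔟pos, mul_comm]
    norm_cast
  -- assemble
  have hh : (rayMult h𝔟 hcop N : ℂ) ≠ 0 := by exact_mod_cast rayMult_ne_zero h𝔟 hcop hN0 hN hNm
  have h2r : (2 : ℂ) ^ Fintype.card {w : NumberField.InfinitePlace K // w.IsReal} ≠ 0 := pow_ne_zero _ two_ne_zero
  have hNb : ((Ideal.absNorm 𝔟 : ℕ) : ℂ) ≠ 0 := by exact_mod_cast h𝔟pos.ne'
  have hNbs : ((Ideal.absNorm 𝔟 : ℕ) : ℂ) ^ s ≠ 0 := fun h ↦ hNb ((Complex.cpow_eq_zero_iff _ _).mp h).1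
  rw [sum_pieceDirichlet_sub_eq 𝔪 𝔟 N hs, h1, h2, Complex.cpow_neg]
  field_simp

end Assembly

/-! ### Hecke's theorem for narrow ray classes from the continuation of the signed coset series -/

/-- `𝔪𝔟⁻¹ ≠ 0`. [folklore] -/
theorem rayModulus_ne_zero {𝔪 𝔟 : Ideal (𝓞 K)} (h𝔪 : 𝔪 ≠ ⊥) (h𝔟 : 𝔟 ≠ ⊥) : rayModulus K 𝔪 𝔟 ≠ 0 :=
  mul_ne_zero (FractionalIdeal.coeIdeal_ne_zero.mpr h𝔪) (inv_ne_zero (FractionalIdeal.coeIdeal_ne_zero.mpr h𝔟))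

/-- **Hecke's theorem for the partial zeta functions of narrow ray classes, from the continuation of the
signed coset Dirichlet series** (Neukirch VII §8 Remark 1: split `J^𝔪/P^𝔪` into its classes and proceed as
for the Dedekind zeta function): if for every nonzero fractional ideal `𝔞`, every even `N ≠ 0` with
`(u_i^N - 1)·1 ∈ 𝔞` and every set `p` of real places the signed series `D_{p,+} - D_{p,-}` of the coset
`1 + 𝔞` (`pieceDirichlet`) extends to a function meromorphic on `ℂ` and holomorphic off `{0, 1}`, then
`rayClassPartialZeta_hasMeromorphicContinuation K` holds: by `rayClassPartialZeta_eq_sum_pieceDirichlet`,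
`Z_𝔪(𝔟, s)` is `h⁻¹ 2^{-r₁} 𝔑(𝔟)^{-s}` times a finite sum of such functions.
[cite: NeukirchANT1999, Ch. VII §8 Remark 1 (after (8.6)) and (8.5) Theorem] -/
theorem rayClassPartialZeta_hasMeromorphicContinuation_of_pieceDirichlet
    (h : ∀ (p : Finset {w : NumberField.InfinitePlace K // w.IsReal}) (I : (FractionalIdeal (𝓞 K)⁰ K)ˣ) (N : ℕ),
      N ≠ 0 → Even N →
      (∀ i, (((fundSystem K i : (𝓞 K)ˣ) : K) ^ N - 1) * 1 ∈ (I : FractionalIdeal (𝓞 K)⁰ K)) →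
      ∃ Z : ℂ → ℂ, Meromorphic Z ∧ DifferentiableOn ℂ Z ({0, 1} : Set ℂ)ᶜ ∧
        ∀ s : ℂ, 1 < s.re → Z s =
          NumberField.pieceDirichlet K p 1 (I : FractionalIdeal (𝓞 K)⁰ K) 1 N s -
            NumberField.pieceDirichlet K p (-1) (I : FractionalIdeal (𝓞 K)⁰ K) 1 N s) :
    rayClassPartialZeta_hasMeromorphicContinuation K := by
  intro 𝔪 h𝔪 𝔟 h𝔟 hcop
  obtain ⟨N, hN0, hN, hNu⟩ := exists_even_pow_sub_one_mem (K := K) h𝔪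
  have hNm : ∀ i, ((fundSystem K i : (𝓞 K)ˣ) : 𝓞 K) ^ N - 1 ∈ 𝔪 := fun i ↦ hNu _
  set I : (FractionalIdeal (𝓞 K)⁰ K)ˣ := Units.mk0 (rayModulus K 𝔪 𝔟) (rayModulus_ne_zero h𝔪 h𝔟) with hI
  have hIc : (I : FractionalIdeal (𝓞 K)⁰ K) = rayModulus K 𝔪 𝔟 := rfl
  have hV : ∀ i, (((fundSystem K i : (𝓞 K)ˣ) : K) ^ N - 1) * 1 ∈ (I : FractionalIdeal (𝓞 K)⁰ K) := by
    intro i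
    rw [mul_one, hIc]
    have := coeIdeal_le_rayModulus 𝔪 h𝔟 (FractionalIdeal.mem_coeIdeal_of_mem (𝓞 K)⁰ (hNm i))
    rwa [map_sub, map_pow, map_one] at this
  choose Z hZm hZd hZs using fun p : Finset {w : NumberField.InfinitePlace K // w.IsReal} ↦ h p I N hN0 hN hV
  set C : ℂ → ℂ := fun s ↦ ((rayMult h𝔟 hcop N : ℂ))⁻¹ *
    ((2 : ℂ) ^ Fintype.card {w : NumberField.InfinitePlace K // w.IsReal})⁻¹ * ((Ideal.absNorm 𝔟 : ℕ) : ℂ) ^ (-s) with hC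
  have hNb : ((Ideal.absNorm 𝔟 : ℕ) : ℂ) ≠ 0 := by
    have : (0 : ℝ) < Ideal.absNorm 𝔟 := by
      exact_mod_cast Nat.pos_of_ne_zero (by rwa [ne_eq, Ideal.absNorm_eq_zero_iff])
    exact_mod_cast this.ne'
  have hCd : Differentiable ℂ C := by
    rw [hC]
    exact (differentiable_const _).mul (differentiable_id.neg.const_cpow (Or.inl hNb))
  refine ⟨fun s ↦ C s * ∑ p : Finset {w : NumberField.InfinitePlace K // w.IsReal}, Z p s, fun s ↦ ?_, ?_, fun s hs ↦ ?_⟩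
  · exact ((hCd.analyticAt s).meromorphicAt).mul (MeromorphicAt.fun_sum fun p _ ↦ hZm p s)
  · exact (hCd.differentiableOn).mul (DifferentiableOn.fun_sum fun p _ ↦ hZd p)
  · simp only [hIc] at hZs
    show C s * ∑ p, Z p s = rayClassPartialZeta 𝔪 𝔟 s
    rw [rayClassPartialZeta_eq_sum_pieceDirichlet h𝔟 hcop hN0 hN hNm hs, hC,
      Finset.sum_congr rfl fun p _ ↦ hZs p s hs]

/-- **Hecke's theorem for ray class characters from the continuation of the signed coset series**
(with `rayClassLSeries_hasMeromorphicContinuation_of_partialZeta` of `RayClassPartialZeta.lean`).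
[cite: NeukirchANT1999, Ch. VII §8 (8.5)–(8.6) and Remark 1] -/
theorem rayClassLSeries_hasMeromorphicContinuation_of_pieceDirichlet
    (h : ∀ (p : Finset {w : NumberField.InfinitePlace K // w.IsReal}) (I : (FractionalIdeal (𝓞 K)⁰ K)ˣ) (N : ℕ),
      N ≠ 0 → Even N →
      (∀ i, (((fundSystem K i : (𝓞 K)ˣ) : K) ^ N - 1) * 1 ∈ (I : FractionalIdeal (𝓞 K)⁰ K)) →
      ∃ Z : ℂ → ℂ, Meromorphic Z ∧ DifferentiableOn ℂ Z ({0, 1} : Set ℂ)ᶜ ∧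
        ∀ s : ℂ, 1 < s.re → Z s =
          NumberField.pieceDirichlet K p 1 (I : FractionalIdeal (𝓞 K)⁰ K) 1 N s -
            NumberField.pieceDirichlet K p (-1) (I : FractionalIdeal (𝓞 K)⁰ K) 1 N s) :
    rayClassLSeries_hasMeromorphicContinuation K :=
  rayClassLSeries_hasMeromorphicContinuation_of_partialZeta
    (rayClassPartialZeta_hasMeromorphicContinuation_of_pieceDirichlet h)

end Literature.NumberTheory.LFunctions
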